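/-
  Summits/AtomisticToContinuum/Crystallization/Theorems/OverbindingBudgetAffineFarShellCovering.lean

  residual stmt-AtomisticToContinuum-31280 · slot Z `FarAggregatePricing 12 (1/25) (1/2000) (1/(2·10⁷))` · the L-slot, leaf SM = LAB ∧ DRIFT
  (…FarMatchingSplit p845178): the geometric input of DRIFT — the `45°` covering property of the close-packing shells and the UNIFORM DESCENT
  of a close-packed stacking towards a base site; decomp-a2c lens-4 «minimal counterexample / extremal reduction», generation 55.
  Imports ONLY `Literature.MathematicalPhysics.StatisticalMechanics.BarlowTexturedSet`.  0 sorry · 0 axiom · no instance · no notation · no option.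
-/
import Literature.MathematicalPhysics.StatisticalMechanics.BarlowTexturedSet

/-! # Shell covering and uniform descent in a close-packed stacking (PROVED)

* §1 `three_mul_sq_add_sq_le_or`, `exists_mem_hexagonSet_le_inner`: the hexagon `H = {±u₁, ±u₂, ±(u₁ − u₂)}` covers the horizontal
  directions within `30°` (`√3 ‖d‖ ≤ ⟪d, η⟫`);
* §2 `exists_max_sq_of_sum_eq_zero`, `exists_mem_holeTriple_le_inner`: a hole triple `σ{w, w − u₁, w − u₂}` covers the horizontal directions
  within `60°` (`‖d‖² ≤ 3⟪d, t⟫²`, `⟪d, t⟫ ≥ 0`);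
* §3 `exists_mem_layerShell_le_inner`: a layer shell `layerShell σ σ'` (`σ, σ' = ±1`) covers ALL directions within `45°`
  (`√2 ‖d‖ ≤ ⟪d, x⟫` for some shell point `x`, `‖x‖ = 2`); `exists_mem_barlowShell_le_inner`: the unit-spacing form
  (`√2 ‖d‖ ≤ 2⟪d, v⟫`, `v ∈ barlowShell σ τ`).
  §1–§3 are a PORT (statements re-typed at the call sites' orientation `⟪d, ·⟫`, proofs verbatim up to that) of
  `exists_abs_ge_sqrt_three_mul`, `exists_mem_hexagonSet_inner_ge`, `le_three_mul_sq_max`, `exists_mem_holeTriple_inner_ge`,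
  `exists_mem_layerShell_inner_ge` of the tree file `Summits/…/Theorems/BrittleRungDescentSoftLayerPropagationCovering.lean`, which is NOT
  BUILT in the current library (no module of the `BrittleRungDescentSoftLayerPropagation*` family has an `.olean`; the farm answers
  `remote:stale:…:unbuilt:…Covering`) and therefore cannot be imported.
* §4 ★ `exists_closer_neighbour` (UNIFORM DESCENT): every nonzero site `p` of a close-packed stacking `barlowStacking 1 √(2/3) s` through
  the origin has a TOUCHING site `q` (`dist p q = 1`) with `‖q‖ ≤ ‖p‖ − 1/5`: Hales's shell theorem at unit spacing
  (`touching_barlowStacking_eq_image_barlowShell`) realises the shell `p + barlowShell (s m) (−s (m−1))` inside the stacking, §3 applied to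
  `d = −p` gives `‖q‖² ≤ ‖p‖² − √2 ‖p‖ + 1`, and `‖p‖ ≥ 1` (ideal packing, `le_dist_of_mem_barlowStacking_ideal`) gives
  `‖p‖² − √2‖p‖ + 1 ≤ (‖p‖ − 1/5)²`.
-/

namespace Summit.AtomisticToContinuum.Crystallization.Theorems.OverbindingBudgetAffineFarSmoothSplit

open scoped RealInnerProductSpace
open Literature.MathematicalPhysics.StatisticalMechanics
open Literature.Geometry.DiscreteGeometry

/-! ## §1  The hexagon covers the horizontal directions within `30°` (PORT, PROVED) -/

/-- Among `2x`, `x + √3 y`, `x − √3 y` one has square `≥ 3 (x² + y²)`. [folklore] -/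
theorem three_mul_sq_add_sq_le_or (x y : ℝ) :
    3 * (x ^ 2 + y ^ 2) ≤ 4 * x ^ 2 ∨ 3 * (x ^ 2 + y ^ 2) ≤ (x + Real.sqrt 3 * y) ^ 2 ∨
      3 * (x ^ 2 + y ^ 2) ≤ (x - Real.sqrt 3 * y) ^ 2 := by
  have h3 : Real.sqrt 3 ^ 2 = 3 := sqrt_three_sq
  by_contra h
  push Not at h
  obtain ⟨h1, h2, h3'⟩ := h
  have hx : x ^ 2 < 3 * y ^ 2 := by nlinarith
  have ha : 2 * Real.sqrt 3 * (x * y) < 2 * x ^ 2 := by nlinarith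
  have hb : -(2 * Real.sqrt 3 * (x * y)) < 2 * x ^ 2 := by nlinarith
  have hc : 3 * (x * y) ^ 2 < x ^ 4 := by
    have hab : |Real.sqrt 3 * (x * y)| < x ^ 2 := abs_lt.2 ⟨by linarith, by linarith⟩
    have h0 : 0 ≤ |Real.sqrt 3 * (x * y)| := abs_nonneg _
    have := mul_self_lt_mul_self h0 hab
    rw [← sq, sq_abs, mul_pow, h3] at this
    nlinarith
  have hx0 : 0 < x ^ 2 := by
    by_contra h0
    have : x ^ 2 = 0 := le_antisymm (not_lt.1 h0) (sq_nonneg x)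
    rw [show x ^ 4 = (x ^ 2) ^ 2 by ring, this] at hc
    nlinarith [sq_nonneg (x * y)]
  nlinarith

/-- **The hexagon covers the horizontal directions**: for a horizontal `d` some `η ∈ hexagonSet` has `⟪d, η⟫ ≥ √3 ‖d‖`. [folklore] -/
theorem exists_mem_hexagonSet_le_inner {d : EuclideanSpace ℝ (Fin 3)} (hd : d 2 = 0) :
    ∃ η ∈ hexagonSet, Real.sqrt 3 * ‖d‖ ≤ ⟪d, η⟫ := by
  suffices h : ∃ η ∈ hexagonSet, Real.sqrt 3 * ‖d‖ ≤ ⟪η, d⟫ by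
    obtain ⟨η, hη, h⟩ := h
    exact ⟨η, hη, by rwa [real_inner_comm]⟩
  have h3 : Real.sqrt 3 ^ 2 = 3 := sqrt_three_sq
  have hs3 : 0 < Real.sqrt 3 := by positivity
  have hn : ‖d‖ ^ 2 = d 0 ^ 2 + d 1 ^ 2 := by rw [norm_sq_fin3, hd]; ring
  have hn0 : 0 ≤ ‖d‖ := norm_nonneg d
  have key : ∀ η : EuclideanSpace ℝ (Fin 3), η ∈ hexagonSet → -η ∈ hexagonSet →
      3 * (d 0 ^ 2 + d 1 ^ 2) ≤ ⟪η, d⟫ ^ 2 → ∃ η ∈ hexagonSet, Real.sqrt 3 * ‖d‖ ≤ ⟪η, d⟫ := by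
    intro η hη hη' hsq
    have hsq' : (Real.sqrt 3 * ‖d‖) ^ 2 ≤ |⟪η, d⟫| ^ 2 := by rw [mul_pow, h3, hn, sq_abs]; exact hsq
    have habs : Real.sqrt 3 * ‖d‖ ≤ |⟪η, d⟫| := (abs_le_of_sq_le_sq' hsq' (abs_nonneg _)).2
    rcases le_or_gt 0 ⟪η, d⟫ with h0 | h0
    · exact ⟨η, hη, by rwa [abs_of_nonneg h0] at habs⟩
    · exact ⟨-η, hη', by rw [inner_neg_left]; rwa [abs_of_neg h0] at habs⟩
  rcases three_mul_sq_add_sq_le_or (d 0) (d 1) with h | h | h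
  · refine key (triangularVec₁ 2) (by simp [hexagonSet]) (by simp [hexagonSet]) ?_
    rw [inner_fin3]; simp; nlinarith [h]
  · refine key (triangularVec₂ 2) (by simp [hexagonSet]) (by simp [hexagonSet]) ?_
    rw [inner_fin3]; simp [hd]; nlinarith [h]
  · refine key (triangularVec₁ 2 - triangularVec₂ 2) (by simp [hexagonSet])
      (by rw [neg_sub]; simp [hexagonSet]) ?_
    rw [inner_fin3]; simp [hd]; nlinarith [h]

/-! ## §2  A hole triple covers the horizontal directions within `60°` (PORT, PROVED) -/

/-- Of three reals summing to `0`, the largest `M` is nonnegative and `x² + y² + z² ≤ 6 M²`. [folklore] -/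
theorem exists_max_sq_of_sum_eq_zero {x y z : ℝ} (hsum : x + y + z = 0) :
    ∃ M : ℝ, (M = x ∨ M = y ∨ M = z) ∧ 0 ≤ M ∧ x ^ 2 + y ^ 2 + z ^ 2 ≤ 6 * M ^ 2 := by
  rcases le_total y x with hyx | hxy
  · rcases le_total z x with hzx | hxz
    · refine ⟨x, Or.inl rfl, by nlinarith, ?_⟩
      nlinarith [mul_nonneg (sub_nonneg.2 hyx) (sub_nonneg.2 hzx)]
    · refine ⟨z, Or.inr (Or.inr rfl), by nlinarith, ?_⟩
      nlinarith [mul_nonneg (sub_nonneg.2 hxz) (sub_nonneg.2 (hyx.trans hxz))]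
  · rcases le_total z y with hzy | hyz
    · refine ⟨y, Or.inr (Or.inl rfl), by nlinarith, ?_⟩
      nlinarith [mul_nonneg (sub_nonneg.2 hxy) (sub_nonneg.2 hzy)]
    · refine ⟨z, Or.inr (Or.inr rfl), by nlinarith, ?_⟩
      nlinarith [mul_nonneg (sub_nonneg.2 (hxy.trans hyz)) (sub_nonneg.2 hyz)]

/-- **A hole triple covers the horizontal directions**: for a horizontal `d` and `σ = ±1` some `t ∈ holeTriple σ` has `⟪d, t⟫ ≥ 0` and
`‖d‖² ≤ 3 ⟪d, t⟫²`. [folklore] -/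
theorem exists_mem_holeTriple_le_inner {d : EuclideanSpace ℝ (Fin 3)} (hd : d 2 = 0) {σ : ℝ} (hσ : σ = 1 ∨ σ = -1) :
    ∃ t ∈ holeTriple σ, 0 ≤ ⟪d, t⟫ ∧ ‖d‖ ^ 2 ≤ 3 * ⟪d, t⟫ ^ 2 := by
  suffices h : ∃ t ∈ holeTriple σ, 0 ≤ ⟪t, d⟫ ∧ ‖d‖ ^ 2 ≤ 3 * ⟪t, d⟫ ^ 2 by
    obtain ⟨t, ht, h⟩ := h
    exact ⟨t, ht, by rwa [real_inner_comm]⟩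
  have h3 : Real.sqrt 3 ^ 2 = 3 := sqrt_three_sq
  have hn : ‖d‖ ^ 2 = d 0 ^ 2 + d 1 ^ 2 := by rw [norm_sq_fin3, hd]; ring
  set x := ⟪σ • (barlowOffset 2 : EuclideanSpace ℝ (Fin 3)), d⟫ with hx
  set y := ⟪σ • (barlowOffset 2 - triangularVec₁ 2 : EuclideanSpace ℝ (Fin 3)), d⟫ with hy
  set z := ⟪σ • (barlowOffset 2 - triangularVec₂ 2 : EuclideanSpace ℝ (Fin 3)), d⟫ with hz
  have hσ2 : σ ^ 2 = 1 := by rcases hσ with rfl | rfl <;> norm_num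
  have ex : x = σ * (d 0 + Real.sqrt 3 / 3 * d 1) := by
    rw [hx, real_inner_smul_left, inner_fin3]
    simp only [frameW_apply_zero, frameW_apply_one, frameW_apply_two, hd, mul_zero, add_zero, one_mul]
  have ey : y = σ * (-d 0 + Real.sqrt 3 / 3 * d 1) := by
    rw [hy, real_inner_smul_left, inner_fin3]
    simp only [PiLp.sub_apply, frameW_apply_zero, frameW_apply_one, frameW_apply_two, frameU_apply_zero,
      frameU_apply_one, frameU_apply_two, hd, mul_zero, add_zero]
    ring
  have ez : z = σ * (-(2 * Real.sqrt 3 / 3) * d 1) := by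
    rw [hz, real_inner_smul_left, inner_fin3]
    simp only [PiLp.sub_apply, frameW_apply_zero, frameW_apply_one, frameW_apply_two, frameV_apply_zero,
      frameV_apply_one, frameV_apply_two, hd, mul_zero, add_zero]
    ring
  have hsum : x + y + z = 0 := by rw [ex, ey, ez]; ring
  have hsq : x ^ 2 + y ^ 2 + z ^ 2 = 2 * ‖d‖ ^ 2 := by
    rw [ex, ey, ez, hn]; linear_combination (2 / 3 * d 1 ^ 2 * σ ^ 2) * h3 + (2 * (d 0 ^ 2 + d 1 ^ 2)) * hσ2
  obtain ⟨M, hM, hM0, hle⟩ := exists_max_sq_of_sum_eq_zero hsum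
  rw [hsq] at hle
  rcases hM with rfl | rfl | rfl
  · exact ⟨_, by simp [holeTriple], hM0, by linarith⟩
  · exact ⟨_, by simp [holeTriple], hM0, by linarith⟩
  · exact ⟨_, by simp [holeTriple], hM0, by linarith⟩

/-! ## §3  A layer shell covers all directions within `45°` (PORT, PROVED); the unit-spacing form -/

/-- **Every direction is within `45°` of a point of a layer shell**: for every `d` some `x ∈ layerShell σ σ′` (`σ, σ′ = ±1`) has
`⟪d, x⟫ ≥ √2 ‖d‖`. [folklore] -/
theorem exists_mem_layerShell_le_inner {σ σ' : ℝ} (hσ : σ = 1 ∨ σ = -1) (hσ' : σ' = 1 ∨ σ' = -1)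
    (d : EuclideanSpace ℝ (Fin 3)) : ∃ x ∈ layerShell σ σ', Real.sqrt 2 * ‖d‖ ≤ ⟪d, x⟫ := by
  suffices h : ∃ p ∈ layerShell σ σ', Real.sqrt 2 * ‖d‖ ≤ ⟪p, d⟫ by
    obtain ⟨p, hp, h⟩ := h
    exact ⟨p, hp, by rwa [real_inner_comm]⟩
  have h2 : Real.sqrt 2 ^ 2 = 2 := Real.sq_sqrt (by norm_num)
  have h3 : Real.sqrt 3 ^ 2 = 3 := sqrt_three_sq
  have hs2 : 0 < Real.sqrt 2 := by positivity
  have hs3 : 0 < Real.sqrt 3 := by positivity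
  have hh := layerSpacing_pos
  have hh2 := layerSpacing_sq
  -- horizontal part `dh` and height `d 2`
  set dh : EuclideanSpace ℝ (Fin 3) := d - (d 2 / layerSpacing) • layerNormal layerSpacing with hdh
  have hdh2 : dh 2 = 0 := by simp [hdh, hh.ne']
  have hsplit : d = dh + (d 2 / layerSpacing) • layerNormal layerSpacing := by rw [hdh]; abel
  have hnd : ‖d‖ ^ 2 = ‖dh‖ ^ 2 + d 2 ^ 2 := by
    rw [norm_sq_fin3, norm_sq_fin3, hdh2]
    simp [hdh]
  have ha0 : 0 ≤ ‖dh‖ := norm_nonneg _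
  have hd0 : 0 ≤ ‖d‖ := norm_nonneg _
  have hor : ∀ q : EuclideanSpace ℝ (Fin 3), q 2 = 0 → ⟪q, d⟫ = ⟪q, dh⟫ := by
    intro q hq
    rw [hsplit, inner_add_right, real_inner_smul_right]
    have : ⟪q, layerNormal layerSpacing⟫ = 0 := by rw [inner_fin3]; simp [hq]
    rw [this, mul_zero, add_zero]
  have lift : ∀ q : EuclideanSpace ℝ (Fin 3), q 2 = 0 → ∀ s : ℝ,
      ⟪q + s • layerNormal layerSpacing, d⟫ = ⟪q, dh⟫ + s * layerSpacing * d 2 := by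
    intro q hq s
    rw [inner_add_left, hor q hq, real_inner_smul_left]
    have : ⟪layerNormal layerSpacing, d⟫ = layerSpacing * d 2 := by rw [inner_fin3]; simp
    rw [this]; ring
  by_cases hflat : 2 * ‖d‖ ^ 2 ≤ 3 * ‖dh‖ ^ 2
  · -- flat direction: the hexagon
    obtain ⟨η, hη, hle⟩ := exists_mem_hexagonSet_le_inner hdh2
    rw [real_inner_comm] at hle
    refine ⟨η, hexagonSet_subset_layerShell _ _ hη, ?_⟩
    rw [hor η (apply_two_of_mem_hexagonSet hη)]
    have h1 : (Real.sqrt 2 * ‖d‖) ^ 2 ≤ (Real.sqrt 3 * ‖dh‖) ^ 2 := by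
      rw [mul_pow, mul_pow, h2, h3]; exact hflat
    have h1' := (abs_le_of_sq_le_sq' h1 (mul_nonneg hs3.le ha0)).2
    linarith
  · -- steep direction: the hole triple on the side of `d`
    push Not at hflat
    have hside : ∀ {τ s : ℝ}, (τ = 1 ∨ τ = -1) → (s = 1 ∨ s = -1) → 0 ≤ s * d 2 →
        (∀ t ∈ holeTriple τ, t + s • layerNormal layerSpacing ∈ layerShell σ σ') →
        ∃ p ∈ layerShell σ σ', Real.sqrt 2 * ‖d‖ ≤ ⟪p, d⟫ := by
      intro τ s hτ hs hsd hmem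
      obtain ⟨t, ht, ht0, htle⟩ := exists_mem_holeTriple_le_inner hdh2 hτ
      rw [real_inner_comm] at ht0 htle
      refine ⟨t + s • layerNormal layerSpacing, hmem t ht, ?_⟩
      rw [lift t (apply_two_of_mem_holeTriple ht) s]
      have hs2' : s ^ 2 = 1 := by rcases hs with rfl | rfl <;> norm_num
      have hb2 : (s * d 2) ^ 2 = d 2 ^ 2 := by rw [mul_pow, hs2', one_mul]
      set a := ‖dh‖ with ha
      set b := s * d 2 with hb
      set m := ⟪t, dh⟫ with hm
      have hab : a ^ 2 < 2 * b ^ 2 := by rw [hb2]; nlinarith [hnd]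
      have hb0 : 0 ≤ b := hsd
      have hma : a ≤ Real.sqrt 3 * m := by
        have : a ^ 2 ≤ (Real.sqrt 3 * m) ^ 2 := by rw [mul_pow, h3]; exact htle
        exact (abs_le_of_sq_le_sq' this (mul_nonneg hs3.le ht0)).2
      have hkey : 2 * (a ^ 2 + b ^ 2) ≤ (m + layerSpacing * b) ^ 2 := by
        have hab' : a ≤ Real.sqrt 2 * b := by
          have : a ^ 2 ≤ (Real.sqrt 2 * b) ^ 2 := by rw [mul_pow, h2]; exact hab.le
          exact (abs_le_of_sq_le_sq' this (mul_nonneg hs2.le hb0)).2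
        have hhs : layerSpacing * Real.sqrt 3 = 2 * Real.sqrt 2 := by
          have : (layerSpacing * Real.sqrt 3) ^ 2 = (2 * Real.sqrt 2) ^ 2 := by
            rw [mul_pow, mul_pow, hh2, h3, h2]; norm_num
          exact le_antisymm (abs_le_of_sq_le_sq' this.le (mul_nonneg zero_le_two hs2.le)).2
            (abs_le_of_sq_le_sq' this.ge (mul_nonneg hh.le hs3.le)).2
        have hlow : 2 * (a ^ 2 + b ^ 2) * 3 ≤ (a + Real.sqrt 3 * layerSpacing * b) ^ 2 := by
          have e : (a + Real.sqrt 3 * layerSpacing * b) ^ 2 =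
              a ^ 2 + 2 * (layerSpacing * Real.sqrt 3) * (a * b) + 3 * layerSpacing ^ 2 * b ^ 2 := by
            linear_combination (layerSpacing ^ 2 * b ^ 2) * h3
          rw [e, hhs, hh2]
          nlinarith [mul_nonneg (by nlinarith : 0 ≤ 5 * a + Real.sqrt 2 * b) (sub_nonneg.2 hab'), h2]
        have hmono : (a + Real.sqrt 3 * layerSpacing * b) ^ 2 ≤ (Real.sqrt 3 * (m + layerSpacing * b)) ^ 2 := by
          have h0 : 0 ≤ a + Real.sqrt 3 * layerSpacing * b := by positivity
          have h1 : a + Real.sqrt 3 * layerSpacing * b ≤ Real.sqrt 3 * (m + layerSpacing * b) := by nlinarith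
          exact pow_le_pow_left₀ h0 h1 2
        rw [mul_pow, h3] at hmono
        nlinarith
      have hfin : (Real.sqrt 2 * ‖d‖) ^ 2 ≤ (m + layerSpacing * b) ^ 2 := by
        rw [mul_pow, h2, hnd, ← hb2]; exact hkey
      have hpos : 0 ≤ m + layerSpacing * b := by positivity
      calc Real.sqrt 2 * ‖d‖ ≤ m + layerSpacing * b := (abs_le_of_sq_le_sq' hfin hpos).2
        _ = m + s * layerSpacing * d 2 := by rw [hb]; ring
    rcases le_or_gt 0 (d 2) with hz | hz
    · exact hside hσ (Or.inl rfl) (by simpa using hz) fun t ht =>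
        mem_layerShell_iff.2 (Or.inr (Or.inl (by simpa using ht)))
    · exact hside hσ' (Or.inr rfl) (by nlinarith) fun t ht =>
        mem_layerShell_iff.2 (Or.inr (Or.inr (by simpa [sub_eq_add_neg] using ht)))

/-- **The unit-spacing form**: for every `d` some `v ∈ barlowShell σ τ` (`σ, τ = ±1`; `‖v‖ = 1`) has `2⟪d, v⟫ ≥ √2 ‖d‖`. [this file] -/
theorem exists_mem_barlowShell_le_inner {σ τ : ℝ} (hσ : σ = 1 ∨ σ = -1) (hτ : τ = 1 ∨ τ = -1)
    (d : EuclideanSpace ℝ (Fin 3)) : ∃ v ∈ barlowShell σ τ, Real.sqrt 2 * ‖d‖ ≤ 2 * ⟪d, v⟫ := by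
  obtain ⟨x, hx, hle⟩ := exists_mem_layerShell_le_inner hσ hτ d
  refine ⟨(2 : ℝ)⁻¹ • x, ?_, ?_⟩
  · rw [mem_barlowShell_iff, smul_inv_smul₀ (two_ne_zero : (2 : ℝ) ≠ 0)]; exact hx
  · rw [real_inner_smul_right]; linarith

/-! ## §4  ★ Uniform descent towards a base site (PROVED) -/

/-- ★ **UNIFORM DESCENT (PROVED).** Every nonzero site `p` of a close-packed stacking `barlowStacking 1 √(2/3) s` (`s` a Hägg sequence)
containing the origin has a touching site `q` (`dist p q = 1`) with `‖q‖ ≤ ‖p‖ − 1/5`. [this file] -/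
theorem exists_closer_neighbour {s : ℤ → ℤ} (hs : IsHaggSeq s) {p : EuclideanSpace ℝ (Fin 3)}
    (hp : p ∈ barlowStacking 1 (Real.sqrt (2 / 3)) s) (h0 : (0 : EuclideanSpace ℝ (Fin 3)) ∈ barlowStacking 1 (Real.sqrt (2 / 3)) s)
    (hp0 : p ≠ 0) :
    ∃ q ∈ barlowStacking 1 (Real.sqrt (2 / 3)) s, dist p q = 1 ∧ ‖q‖ ≤ ‖p‖ - 1 / 5 := by
  obtain ⟨m, a, b, hpm⟩ := hp
  have hσ : ((s m : ℤ) : ℝ) = 1 ∨ ((s m : ℤ) : ℝ) = -1 := by rcases hs m with h | h <;> simp [h]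
  have hτ : (-((s (m - 1) : ℤ) : ℝ)) = 1 ∨ (-((s (m - 1) : ℤ) : ℝ)) = -1 := by
    rcases hs (m - 1) with h | h <;> simp [h]
  obtain ⟨v, hv, hle⟩ := exists_mem_barlowShell_le_inner hσ hτ (-p)
  have hmem : p + v ∈ {z | z ∈ barlowStacking 1 (Real.sqrt (2 / 3)) s ∧
      dist z (barlowPos 1 (Real.sqrt (2 / 3)) s m a b) = 1} := by
    rw [touching_barlowStacking_eq_image_barlowShell hs m a b, ← hpm]
    exact ⟨v, hv, rfl⟩
  obtain ⟨hq, hd⟩ := hmem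
  rw [← hpm, dist_eq_norm, add_sub_cancel_left] at hd
  have h1 : 1 ≤ ‖p‖ := by
    have := le_dist_of_mem_barlowStacking_ideal hs one_pos
      (by rw [Real.sq_sqrt (by norm_num : (0 : ℝ) ≤ 2 / 3)]; norm_num) ⟨m, a, b, hpm⟩ h0 hp0
    rwa [dist_zero_right] at this
  refine ⟨p + v, hq, by rw [dist_eq_norm, sub_add_cancel_left, norm_neg, hd], ?_⟩
  have hsq : ‖p + v‖ ^ 2 = ‖p‖ ^ 2 + 2 * ⟪p, v⟫ + 1 := by
    rw [norm_add_sq_real, hd]; ring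
  rw [inner_neg_left, norm_neg] at hle
  have h72 : (7 : ℝ) / 5 ≤ Real.sqrt 2 := by
    nlinarith [Real.sq_sqrt (show (0 : ℝ) ≤ 2 by norm_num), Real.sqrt_nonneg 2]
  have hsq' : ‖p + v‖ ^ 2 ≤ (‖p‖ - 1 / 5) ^ 2 := by
    nlinarith [hsq, hle, h72, h1, mul_le_mul_of_nonneg_left h72 (norm_nonneg p)]
  exact (abs_le_of_sq_le_sq' hsq' (by linarith)).2

end Summit.AtomisticToContinuum.Crystallization.Theorems.OverbindingBudgetAffineFarSmoothSplit
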